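import Literature.Probability.LatticeModels.IsingUnfixing
import HarnessLib

/-!
# Changing finitely many boundary spins: the explicit tilt and the ratio formula, proved

Topic `Probability/LatticeModels`. For the finite-volume zero-field Ising model `μ^{η}_{Λ;β,0}` of
`IsingModel` on an arbitrary locally finite graph: replacing the boundary condition `η` by `η^Z`,
equal to `u` on a finite set `Z` of sites outside `Λ` and to `η` elsewhere, tilts every Boltzmann
weight by the explicit local factor `T = ∏_{z ∈ Z} exp(β (u_z - η_z) S_z)`, `S_z = ∑_{y ∈ Λ, y ∼ z} σ_y`
(`isingWeight_fixed_piecewise`, iterating the one-site lemma `isingWeight_fixed_update` of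
`IsingUnfixing`), whence the ratio formula `⟨f⟩^{η^Z}_Λ = ⟨f T⟩^{η}_Λ / ⟨T⟩^{η}_Λ` for observables
reading only the spins of `Λ` (`isingExpect_fixed_piecewise_eq_div`). This is the finite-volume
form of "changing the image spins inside `Λ_R` amounts to a finite-volume perturbation of the system
… if `W` is the perturbation, then `μ'(·) = μ(· e^{-W})/μ(e^{-W})`" (van Enter–Fernández–Sokal 1993,
§4.3.1 Step 2.2, citing Georgii 1988, §7.4).

## References

* A. C. D. van Enter, R. Fernández, A. D. Sokal, J. Stat. Phys. 72 (1993) 879–1167, §4.3.1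
  Step 2.2.
* H.-O. Georgii, *Gibbs Measures and Phase Transitions* (de Gruyter 1988/2011), §7.4.
* S. Friedli, Y. Velenik, *Statistical Mechanics of Lattice Systems* (CUP 2017), §3.1.
-/

noncomputable section

open MeasureTheory Finset

namespace Literature.Probability.LatticeModels

variable {V : Type*} (G : SimpleGraph V) [DecidableEq V] [G.LocallyFinite]

/-- **The Boltzmann weight under a change of finitely many boundary spins** (zero field): if
`Z ∩ Λ = ∅` and `η^Z` is `u` on `Z` and `η` elsewhere, then
`w^{η^Z}_Λ(τ) = w^{η}_Λ(τ) ∏_{z ∈ Z} exp(β (u_z - η_z) S_z(τ·η))`.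
[cite: VanenterFernandezSokal1993, §4.3.1 Step 2.2 (finite-volume perturbation)] -/
theorem isingWeight_fixed_piecewise (β : ℝ) (η u : SpinConfig V) {Λ : Finset V} (Z : Finset V)
    (hZ : ∀ z ∈ Z, z ∉ Λ) (τ : Λ → ℤˣ) :
    isingWeight G Λ β 0 (.fixed fun y => if y ∈ Z then u y else η y) τ =
      isingWeight G Λ β 0 (.fixed η) τ *
        ∏ z ∈ Z, Real.exp (β * ((((u z : ℤ) : ℝ) - ((η z : ℤ) : ℝ)) *
          nbrSum G Λ z (glue Λ τ (.fixed η)))) := by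
  induction Z using Finset.induction_on with
  | empty => simp
  | insert a Z haZ ih =>
    have haΛ : a ∉ Λ := hZ a (Finset.mem_insert_self a Z)
    have hZ' : ∀ z ∈ Z, z ∉ Λ := fun z hz => hZ z (Finset.mem_insert_of_mem hz)
    set ηZ : SpinConfig V := fun y => if y ∈ Z then u y else η y with hηZ
    have hupd : (fun y => if y ∈ insert a Z then u y else η y) = Function.update ηZ a (u a) := by
      funext y
      by_cases hya : y = a
      · subst hya; simp
      · rw [Function.update_of_ne hya]
        simp [hηZ, Finset.mem_insert, hya]
    have hηZa : ηZ a = η a := by simp [hηZ, haZ]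
    have hS : nbrSum G Λ a (glue Λ τ (.fixed ηZ)) = nbrSum G Λ a (glue Λ τ (.fixed η)) :=
      nbrSum_congr G Λ a fun x hx => by rw [glue_apply_of_mem _ _ _ hx, glue_apply_of_mem _ _ _ hx]
    rw [hupd, isingWeight_fixed_update G haΛ β ηZ (u a) τ, ih hZ', Finset.prod_insert haZ, hS]
    simp only [spinAt, hηZa]
    ring

/-- **The ratio formula for a change of finitely many boundary spins**: under the hypotheses of
`isingWeight_fixed_piecewise`, for a measurable `f` reading only the spins of `Λ`,
`⟨f⟩^{η^Z}_{Λ;β,0} = ⟨f T⟩^{η}_{Λ;β,0} / ⟨T⟩^{η}_{Λ;β,0}` with the tilt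
`T = ∏_{z ∈ Z} exp(β (u_z - η_z) S_z)` ("if `W` is the perturbation, then
`μ'(·) = μ(· e^{-W})/μ(e^{-W})`"). [cite: VanenterFernandezSokal1993, §4.3.1 Step 2.2 (finite-volume perturbation)] -/
theorem isingExpect_fixed_piecewise_eq_div (β : ℝ) (η u : SpinConfig V) {Λ : Finset V}
    (Z : Finset V) (hZ : ∀ z ∈ Z, z ∉ Λ) {f : SpinConfig V → ℝ} (hfm : Measurable f)
    (hf : ∀ σ σ' : SpinConfig V, (∀ x ∈ Λ, σ x = σ' x) → f σ = f σ') :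
    isingExpect G Λ β 0 (.fixed fun y => if y ∈ Z then u y else η y) f =
      isingExpect G Λ β 0 (.fixed η)
          (fun σ => f σ * ∏ z ∈ Z, Real.exp (β * ((((u z : ℤ) : ℝ) - ((η z : ℤ) : ℝ)) *
            nbrSum G Λ z σ))) /
        isingExpect G Λ β 0 (.fixed η)
          (fun σ => ∏ z ∈ Z, Real.exp (β * ((((u z : ℤ) : ℝ) - ((η z : ℤ) : ℝ)) *
            nbrSum G Λ z σ))) := by
  set T : SpinConfig V → ℝ := fun σ => ∏ z ∈ Z, Real.exp (β * ((((u z : ℤ) : ℝ) - ((η z : ℤ) : ℝ)) *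
    nbrSum G Λ z σ)) with hT
  have hTm : Measurable T := Finset.measurable_prod _ fun z _ =>
    Real.measurable_exp.comp (((measurable_nbrSum G Λ z).const_mul _).const_mul _)
  have hval : ∀ τ : Λ → ℤˣ, f (glue Λ τ (.fixed fun y => if y ∈ Z then u y else η y)) =
      f (glue Λ τ (.fixed η)) :=
    fun τ => hf _ _ fun x hx => by rw [glue_apply_of_mem _ _ _ hx, glue_apply_of_mem _ _ _ hx]
  have hZpos := isingPartitionFunction_pos G Λ β 0 (.fixed η)
  have hTpos : 0 < isingExpect G Λ β 0 (.fixed η) T := by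
    rw [isingExpect_eq_sum_div G Λ 0 _ β hTm]
    exact div_pos (Finset.sum_pos (fun τ _ => mul_pos (isingWeight_pos G Λ β 0 _ τ)
      (Finset.prod_pos fun z _ => Real.exp_pos _)) Finset.univ_nonempty) hZpos
  have hfTm : Measurable fun σ => f σ * ∏ z ∈ Z, Real.exp (β * ((((u z : ℤ) : ℝ) - ((η z : ℤ) : ℝ)) *
      nbrSum G Λ z σ)) := hfm.mul hTm
  rw [isingExpect_eq_sum_div G Λ 0 _ β hfm, isingExpect_eq_sum_div G Λ 0 _ β hfTm,
    isingExpect_eq_sum_div G Λ 0 _ β hTm, isingPartitionFunction]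
  simp only [isingWeight_fixed_piecewise G β η u Z hZ, hval]
  rw [div_div_div_cancel_right₀ hZpos.ne']
  congr 1
  exact Finset.sum_congr rfl fun τ _ => by ring

end Literature.Probability.LatticeModels

end
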